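import Literature.NumberTheory.Multiplicative.DivisorHeckeRelation
import Mathlib.Algebra.BigOperators.Ring.Finset
import HarnessLib

/-!
# Route `PrimeLevelFamEdge`, crux K_A `MomentsBeyondDiagonal` (stmt-Parity-20007), line «petersson_layers» v4, stub `stub_diag`:
# **weighted divisor-pair combinatorics for the log-decorated diagonal (census R3(ii), first brick)**

At a general even-or-odd `Q` the explicit line series of `…DiagLineSeries` sums, over the Hecke divisors
`d₁ ∣ m₁, d₂ ∣ m₂` with `c = gcd(m₁/d₁, m₂/d₂)`, weights depending on the FACTORISATION `n₁ = d₁e₁, n₂ = d₂e₂` of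
`K = (m₁/c)(m₂/c) = n₁n₂` (the log-decorations `(ℓ − log n_ν)^α`), not only on `K` — so the `τ(uv)`-counting of K_B's
`CornerReduction` (`τ(uv) = #{(d,e) : d∣u, e∣v, (d,e)=1}`, `τ(u)τ(v) = Σ_{c∣(u,v)} τ((u/c)(v/c))`,
`Literature…DivisorHeckeRelation`) must be replaced by its WEIGHTED form. This file proves the two weighted identities
(same bijections as the counting proofs, arbitrary weights in an additive commutative monoid):

* `sum_divisors_mul_eq_sum_coprime_pairs` — **`Σ_{D ∣ uv} F(D, uv/D) = Σ_{d∣u, e∣v, (d,e)=1} F((u/d)e, d(v/e))`**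
  (the divisors `D` of `uv` ARE the coprime pairs, `D = (u/d)e`, `uv/D = d(v/e)`);
* `sum_divisorPairs_eq_sum_gcd_fibres` — **`Σ_{d∣u}Σ_{e∣v} H(d,e) = Σ_{c∣(u,v)} Σ_{d'∣u/c, e'∣v/c, (d',e')=1} H(cd', ce')`**
  (sort the pairs by `c = gcd(d,e)`).
Together: a double Hecke-divisor sum with factorisation-dependent weights is a sum over `c ∣ (u,v)` of sums over the
ordered factorisations `n₁n₂ = (u/c)(v/c)` — the decorated replacement for `τ((u/c)(v/c))` in the `Q = 1` chain.

Def-free; theorems only. Helper `--supports stmt-Parity-20007`; closes nothing; K_A, K_B and the Parity summit are NOT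
proved; nothing about Landau–Siegel zeros.

## References
* E. Kowalski, P. Michel, J. VanderKam, J. reine angew. Math. 526 (2000), (10) p. 7 and (21)–(23) pp. 12–13 (Hecke
  relation; the diagonal `n₁n₂`-structure). [cite: KowalskiMichelVanderKam2000, (10) p. 7 — derivation (weighted form)]
-/

open Finset

namespace Summit.Parity.GeneralizedHardyLittlewood.Theorems.MomentsBeyondDiagonal.DiagLines

/-! ### Divisors of a product as coprime pairs, weighted -/

/-- For `D ∣ uv` (`u ≠ 0`): `D / gcd(D,u)` divides `v`. [folklore] -/
theorem div_gcd_dvd_of_dvd_mul' {D u v : ℕ} (hu : u ≠ 0) (hD : D ∣ u * v) :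
    D / Nat.gcd D u ∣ v := by
  set g := Nat.gcd D u with hgdef
  have hg : 0 < g := Nat.gcd_pos_of_pos_right _ (Nat.pos_of_ne_zero hu)
  have hcop : Nat.Coprime (D / g) (u / g) := Nat.coprime_div_gcd_div_gcd hg
  obtain ⟨D', hD'⟩ := Nat.gcd_dvd_left D u
  obtain ⟨u', hu'⟩ := Nat.gcd_dvd_right D u
  rw [← hgdef] at hD' hu'
  have hDg : D / g = D' := by rw [hD', Nat.mul_div_cancel_left D' hg]
  have hug : u / g = u' := by rw [hu', Nat.mul_div_cancel_left u' hg]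
  rw [hDg, hug] at hcop
  rw [hDg]
  have h1 : D' ∣ u' * v := by
    have : g * D' ∣ g * (u' * v) := by rw [← mul_assoc, ← hu', ← hD']; exact hD
    exact Nat.dvd_of_mul_dvd_mul_left hg this
  exact hcop.dvd_of_dvd_mul_left h1

/-- **Divisors of a product as coprime pairs, weighted.** For `u, v ≥ 1` and any weight `F`,
`Σ_{D ∣ uv} F(D, uv/D) = Σ_{(d,e) ∈ div u × div v, (d,e)=1} F((u/d)·e, d·(v/e))`
(the bijection `D ↦ (u/gcd(D,u), D/gcd(D,u))`, inverse `(d,e) ↦ (u/d)e`, of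
`Literature…card_divisors_mul_eq_card_coprime_pairs`, now carrying the complementary divisor `uv/D = d(v/e)`).
[cite: KowalskiMichelVanderKam2000, (10) p. 7 — derivation (weighted counting form)] -/
theorem sum_divisors_mul_eq_sum_coprime_pairs {M : Type*} [AddCommMonoid M] {u v : ℕ} (hu : u ≠ 0) (hv : v ≠ 0)
    (F : ℕ → ℕ → M) :
    ∑ D ∈ (u * v).divisors, F D (u * v / D) =
      ∑ p ∈ (u.divisors ×ˢ v.divisors).filter (fun p => Nat.Coprime p.1 p.2),
        F (u / p.1 * p.2) (p.1 * (v / p.2)) := by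
  symm
  refine Finset.sum_bij' (fun p _ => u / p.1 * p.2) (fun D _ => (u / Nat.gcd D u, D / Nat.gcd D u))
    ?_ ?_ ?_ ?_ ?_
  · -- maps into divisors of `uv`
    rintro ⟨d, e⟩ hp
    simp only [mem_filter, mem_product, Nat.mem_divisors] at hp
    obtain ⟨⟨⟨hd, -⟩, ⟨he, -⟩⟩, -⟩ := hp
    exact Nat.mem_divisors.mpr ⟨mul_dvd_mul (Nat.div_dvd_of_dvd hd) he, mul_ne_zero hu hv⟩
  · -- maps into coprime pairs
    intro D hD
    obtain ⟨hDuv, -⟩ := Nat.mem_divisors.mp hD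
    have hg : 0 < Nat.gcd D u := Nat.gcd_pos_of_pos_right _ (Nat.pos_of_ne_zero hu)
    simp only [mem_filter, mem_product, Nat.mem_divisors]
    refine ⟨⟨⟨Nat.div_dvd_of_dvd (Nat.gcd_dvd_right D u), hu⟩, ⟨div_gcd_dvd_of_dvd_mul' hu hDuv, hv⟩⟩, ?_⟩
    exact (Nat.coprime_div_gcd_div_gcd hg).symm
  · -- left inverse
    rintro ⟨d, e⟩ hp
    simp only [mem_filter, mem_product, Nat.mem_divisors] at hp
    obtain ⟨⟨⟨hd, -⟩, ⟨-, -⟩⟩, hcop⟩ := hp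
    obtain ⟨k, hk⟩ := hd
    have hd0 : 0 < d := Nat.pos_of_ne_zero (by rintro rfl; exact hu (by simpa using hk))
    have hk0 : 0 < k := Nat.pos_of_ne_zero (by rintro rfl; exact hu (by simpa using hk))
    have huk : u / d = k := by rw [hk, Nat.mul_div_cancel_left k hd0]
    have hgcd : Nat.gcd (u / d * e) u = k := by
      rw [huk, hk, mul_comm d k, Nat.gcd_mul_left, Nat.Coprime.gcd_eq_one hcop.symm, mul_one]
    refine Prod.ext ?_ ?_
    · show u / Nat.gcd (u / d * e) u = d
      rw [hgcd, hk, Nat.mul_div_cancel _ hk0]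
    · show u / d * e / Nat.gcd (u / d * e) u = e
      rw [hgcd, huk, Nat.mul_div_cancel_left e hk0]
  · -- right inverse
    intro D hD
    have hug : Nat.gcd D u ∣ u := Nat.gcd_dvd_right D u
    have hDg : Nat.gcd D u ∣ D := Nat.gcd_dvd_left D u
    show u / (u / Nat.gcd D u) * (D / Nat.gcd D u) = D
    rw [Nat.div_div_self hug hu, Nat.mul_div_cancel' hDg]
  · -- the weights agree: `uv/((u/d)e) = d(v/e)`
    rintro ⟨d, e⟩ hp
    simp only [mem_filter, mem_product, Nat.mem_divisors] at hp
    obtain ⟨⟨⟨hd, -⟩, ⟨he, -⟩⟩, -⟩ := hp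
    obtain ⟨k, hk⟩ := hd
    obtain ⟨l, hl⟩ := he
    have hd0 : 0 < d := Nat.pos_of_ne_zero (by rintro rfl; exact hu (by simpa using hk))
    have he0 : 0 < e := Nat.pos_of_ne_zero (by rintro rfl; exact hv (by simpa using hl))
    have huk : u / d = k := by rw [hk, Nat.mul_div_cancel_left k hd0]
    have hvl : v / e = l := by rw [hl, Nat.mul_div_cancel_left l he0]
    show F (u / d * e) (d * (v / e)) = F (u / d * e) (u * v / (u / d * e))
    congr 1
    rw [huk, hvl, hk, hl]
    have hke : 0 < k * e := Nat.mul_pos (Nat.pos_of_ne_zero (by rintro rfl; exact hu (by simpa using hk))) he0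
    symm
    apply Nat.div_eq_of_eq_mul_left hke
    ring

/-! ### Sorting divisor pairs by their gcd, weighted -/

/-- **Pairs with prescribed gcd, weighted**: for `c ∣ u`, `c ∣ v` (`u, v ≥ 1`) and any weight `H`,
`Σ_{(d,e) ∈ div u × div v, gcd(d,e) = c} H(d,e) = Σ_{(d',e') ∈ div(u/c) × div(v/c), (d',e') = 1} H(cd', ce')`.
[folklore] -/
theorem sum_pairs_gcd_eq {M : Type*} [AddCommMonoid M] {u v c : ℕ} (hu : u ≠ 0) (hv : v ≠ 0)
    (hcu : c ∣ u) (hcv : c ∣ v) (H : ℕ → ℕ → M) :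
    ∑ p ∈ (u.divisors ×ˢ v.divisors).filter (fun p => Nat.gcd p.1 p.2 = c), H p.1 p.2 =
      ∑ p ∈ ((u / c).divisors ×ˢ (v / c).divisors).filter (fun p => Nat.Coprime p.1 p.2), H (c * p.1) (c * p.2) := by
  have hc0 : c ≠ 0 := by rintro rfl; exact hu (zero_dvd_iff.mp hcu)
  have hcpos : 0 < c := Nat.pos_of_ne_zero hc0
  obtain ⟨u', rfl⟩ := hcu
  obtain ⟨v', rfl⟩ := hcv
  have hu' : u' ≠ 0 := by rintro rfl; exact hu (mul_zero c)
  have hv' : v' ≠ 0 := by rintro rfl; exact hv (mul_zero c)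
  rw [Nat.mul_div_cancel_left u' hcpos, Nat.mul_div_cancel_left v' hcpos]
  symm
  refine Finset.sum_bij' (fun p _ => (c * p.1, c * p.2)) (fun p _ => (p.1 / c, p.2 / c)) ?_ ?_ ?_ ?_ ?_
  · rintro ⟨d, e⟩ hp
    simp only [mem_filter, mem_product, Nat.mem_divisors] at hp ⊢
    obtain ⟨⟨⟨hd, -⟩, ⟨he, -⟩⟩, hcop⟩ := hp
    refine ⟨⟨⟨mul_dvd_mul_left c hd, hu⟩, ⟨mul_dvd_mul_left c he, hv⟩⟩, ?_⟩
    rw [Nat.gcd_mul_left, Nat.Coprime.gcd_eq_one hcop, mul_one]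
  · rintro ⟨d, e⟩ hp
    simp only [mem_filter, mem_product, Nat.mem_divisors] at hp ⊢
    obtain ⟨⟨⟨hd, -⟩, ⟨he, -⟩⟩, hg⟩ := hp
    have hcd : c ∣ d := hg ▸ Nat.gcd_dvd_left d e
    have hce : c ∣ e := hg ▸ Nat.gcd_dvd_right d e
    obtain ⟨d', rfl⟩ := hcd
    obtain ⟨e', rfl⟩ := hce
    rw [Nat.mul_div_cancel_left d' hcpos, Nat.mul_div_cancel_left e' hcpos]
    refine ⟨⟨⟨Nat.dvd_of_mul_dvd_mul_left hcpos hd, hu'⟩, ⟨Nat.dvd_of_mul_dvd_mul_left hcpos he, hv'⟩⟩, ?_⟩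
    rw [Nat.gcd_mul_left] at hg
    have : Nat.gcd d' e' = 1 := by
      have h := hg
      nth_rewrite 2 [← mul_one c] at h
      exact Nat.eq_of_mul_eq_mul_left hcpos h
    exact this
  · rintro ⟨d, e⟩ hp
    show (c * d / c, c * e / c) = (d, e)
    rw [Nat.mul_div_cancel_left d hcpos, Nat.mul_div_cancel_left e hcpos]
  · rintro ⟨d, e⟩ hp
    simp only [mem_filter, mem_product, Nat.mem_divisors] at hp
    obtain ⟨-, hg⟩ := hp
    have hcd : c ∣ d := hg ▸ Nat.gcd_dvd_left d e
    have hce : c ∣ e := hg ▸ Nat.gcd_dvd_right d e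
    show (c * (d / c), c * (e / c)) = (d, e)
    rw [Nat.mul_div_cancel' hcd, Nat.mul_div_cancel' hce]
  · rintro ⟨d, e⟩ hp
    rfl

/-- **Sorting the divisor pairs by their gcd, weighted** (the weighted Hecke relation): for `u, v ≥ 1` and any `H`,
`Σ_{d∣u} Σ_{e∣v} H(d,e) = Σ_{c ∣ gcd(u,v)} Σ_{(d',e') ∈ div(u/c) × div(v/c), (d',e')=1} H(cd', ce')`
(`H ≡ 1` is `τ(u)τ(v) = Σ_{c∣(u,v)} τ((u/c)(v/c))`).
[cite: KowalskiMichelVanderKam2000, (10) p. 7 — derivation (weighted Hecke relation for divisor pairs)] -/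
theorem sum_divisorPairs_eq_sum_gcd_fibres {M : Type*} [AddCommMonoid M] {u v : ℕ} (hu : u ≠ 0) (hv : v ≠ 0)
    (H : ℕ → ℕ → M) :
    ∑ d ∈ u.divisors, ∑ e ∈ v.divisors, H d e =
      ∑ c ∈ (Nat.gcd u v).divisors,
        ∑ p ∈ ((u / c).divisors ×ˢ (v / c).divisors).filter (fun p => Nat.Coprime p.1 p.2), H (c * p.1) (c * p.2) := by
  rw [← Finset.sum_product (s := u.divisors) (t := v.divisors) (f := fun p : ℕ × ℕ => H p.1 p.2)]
  have hmaps : ∀ p ∈ u.divisors ×ˢ v.divisors, Nat.gcd p.1 p.2 ∈ (Nat.gcd u v).divisors := by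
    rintro ⟨d, e⟩ hp
    simp only [mem_product, Nat.mem_divisors] at hp
    obtain ⟨⟨hd, -⟩, ⟨he, -⟩⟩ := hp
    exact Nat.mem_divisors.mpr ⟨Nat.dvd_gcd ((Nat.gcd_dvd_left d e).trans hd) ((Nat.gcd_dvd_right d e).trans he),
      Nat.gcd_ne_zero_left hu⟩
  rw [← Finset.sum_fiberwise_of_maps_to (g := fun p : ℕ × ℕ => Nat.gcd p.1 p.2)
    (t := (Nat.gcd u v).divisors) (fun p hp => hmaps p hp)]
  refine Finset.sum_congr rfl fun c hc => ?_
  obtain ⟨hcg, -⟩ := Nat.mem_divisors.mp hc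
  have hcu : c ∣ u := hcg.trans (Nat.gcd_dvd_left u v)
  have hcv : c ∣ v := hcg.trans (Nat.gcd_dvd_right u v)
  exact sum_pairs_gcd_eq hu hv hcu hcv H

/-- **The decorated Hecke decomposition**: for `u, v ≥ 1` and any weight `H` on divisor pairs,
`Σ_{d∣u} Σ_{e∣v} H(d,e) = Σ_{c∣(u,v)} Σ_{D ∣ (u/c)(v/c)} H(c·((u/c)/gcd(D,u/c)), c·(D/gcd(D,u/c)))` — every pair
`(d,e)` is `c·(coprime pair)` and the coprime pairs of `(u/c, v/c)` are the divisors `D = ((u/c)/d')e'` of `(u/c)(v/c)`;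
with factorisation-dependent weights this is the replacement for `τ(u)τ(v) = Σ_c τ((u/c)(v/c))` in the log-decorated
(general `Q`) diagonal. [cite: KowalskiMichelVanderKam2000, (10) p. 7 and (21)–(23) — derivation (weighted form)] -/
theorem sum_divisorPairs_eq_sum_gcd_sum_divisors_mul {M : Type*} [AddCommMonoid M] {u v : ℕ} (hu : u ≠ 0)
    (hv : v ≠ 0) (H : ℕ → ℕ → M) :
    ∑ d ∈ u.divisors, ∑ e ∈ v.divisors, H d e =
      ∑ c ∈ (Nat.gcd u v).divisors, ∑ D ∈ (u / c * (v / c)).divisors,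
        H (c * (u / c / Nat.gcd D (u / c))) (c * (D / Nat.gcd D (u / c))) := by
  rw [sum_divisorPairs_eq_sum_gcd_fibres hu hv H]
  refine Finset.sum_congr rfl fun c hc => ?_
  obtain ⟨hcg, -⟩ := Nat.mem_divisors.mp hc
  have hcu : c ∣ u := hcg.trans (Nat.gcd_dvd_left u v)
  have hcv : c ∣ v := hcg.trans (Nat.gcd_dvd_right u v)
  have hc0 : c ≠ 0 := by rintro rfl; exact hu (zero_dvd_iff.mp hcu)
  have huc : u / c ≠ 0 := (Nat.div_ne_zero_iff_of_dvd hcu).mpr ⟨hu, hc0⟩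
  have hvc : v / c ≠ 0 := (Nat.div_ne_zero_iff_of_dvd hcv).mpr ⟨hv, hc0⟩
  -- the coprime pairs of `(u/c, v/c)` as divisors of `(u/c)(v/c)`, with the weight read through the inverse map
  set U := u / c with hU
  set V := v / c with hV
  have key := sum_divisors_mul_eq_sum_coprime_pairs (M := M) huc hvc
    (fun D _ => H (c * (U / Nat.gcd D U)) (c * (D / Nat.gcd D U)))
  rw [key]
  refine Finset.sum_congr rfl fun p hp => ?_
  rcases p with ⟨d, e⟩
  simp only [mem_filter, mem_product, Nat.mem_divisors] at hp
  obtain ⟨⟨⟨hd, -⟩, ⟨-, -⟩⟩, hcop⟩ := hp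
  obtain ⟨k, hk⟩ := hd
  have hd0 : 0 < d := Nat.pos_of_ne_zero (by rintro rfl; exact huc (by simpa using hk))
  have hk0 : 0 < k := Nat.pos_of_ne_zero (by rintro rfl; exact huc (by simpa using hk))
  have huk : U / d = k := by rw [hk, Nat.mul_div_cancel_left k hd0]
  have hgcd : Nat.gcd (U / d * e) U = k := by
    rw [huk, hk, mul_comm d k, Nat.gcd_mul_left, Nat.Coprime.gcd_eq_one hcop.symm, mul_one]
  show H (c * d) (c * e) = H (c * (U / Nat.gcd (U / d * e) U)) (c * (U / d * e / Nat.gcd (U / d * e) U))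
  rw [hgcd, huk, Nat.mul_div_cancel_left e hk0, hk, Nat.mul_div_cancel _ hk0]

end Summit.Parity.GeneralizedHardyLittlewood.Theorems.MomentsBeyondDiagonal.DiagLines
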